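import Summits.QuantumFields.BalabanUV.Beta.GAN24.FluctuationCovarianceLocalisation
import Summits.QuantumFields.BalabanUV.Beta.GAN24.BlockRatesFromSoftResolvent

/-!
# `BalabanUV.Beta.GAN24.FluctuationCovarianceRateTransfer` — binder row G-an2-4 ∕ (CONV-C), route R6 «VALUES, NOT DERIVATIVES», PART 114:
# «𝒢's RATE IS E's RATE PLUS Ξ's RATE PLUS THE SOFT COLUMNS' RATE» — the sandwiched one-step increment `Qf·𝒢′·Qfᵀ − 𝒢` of the FLUCTUATION COVARIANCE
# (the `(kkt)⁻¹₁₁` block, [B9] (3.126)'s `𝒢 = G − ℋQG`) entrywise with fine decay, in letter form (§2) and from the ONE soft letter of PART 113 (§3); with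
# PARTs 105–107, 112, 113: BOTH (CONV-C)-shape clauses of ALL THREE blocks `[[𝒢, ℋ],[ℋᵀ, −𝒮]]` of the bordered inverse from the soft resolvent's decay, its
# sandwiched one-step law `E = Qf·K′⁻¹·Qfᵀ − K⁻¹`, the block locality of `Q` and the upper bound (unit b2b-balaban-gan24-p3, gen 50; v1)

NOT IN PRINT; OUR PROOF (for the ROUTE; [folklore] — `𝒢 = K⁻¹ − ℋ·(K⁻¹Qᵀ)ᵀ` (`CompositionSingular.blocks_eq_of_reg`), hence the exact split
`Qf·𝒢′·Qfᵀ − 𝒢 = E − (Qf·ℋ′ − ℋ)·(Qf·K′⁻¹Q′ᵀ)ᵀ − ℋ·(Qf·K′⁻¹Q′ᵀ − K⁻¹Qᵀ)ᵀ`; PART 106 `sum_exp_fine_le`, PART 105 `abs_minOp_le`, PART 113 `abs_avg_minOp_sub_le_of_soft` ∕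
`abs_avg_col_sub_le_of_soft` BY NAME).
HONEST FRAMING (cell contract, verbatim): «discharging `BetaPertH` makes Bałaban's UV stability UNCONDITIONAL — a real constructive-QFT result; it is NOT the continuum limit and NOT
the Clay problem.»  HONEST DEPENDENCY (verbatim): «continuum YM on T⁴ ⇐ BetaPertH ∧ nine spine estimates (0/9 proved); BetaPertH ⇐ (D1) ∧ (D4) ∧ CAP+tail; G-an2-4 gates asym, D1
and NE2/3/4.»

WHY THIS FILE.  PARTs 105 ∕ 106 put the DECAY of all three blocks on the soft resolvent's decay + UB; PARTs 107 ∕ 112 ∕ 113 put the RATE of the Σ- and Ξ-blocks on ONE fine kernel,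
the sandwiched one-step increment `E` of the soft resolvent.  The remaining entry of the 2 × 2 table is the 𝒢-block's RATE.  `𝒢` lives on the fine lattice at each level, so its
one-step comparison is the doubly averaged `Qf·𝒢′·Qfᵀ − 𝒢`; by `𝒢 = K⁻¹ − ℋ·Cᵀ` (`C = K⁻¹Qᵀ` the soft columns) it splits EXACTLY into `E`, the Ξ-block's averaged mismatch
dressed by the averaged soft columns, and the hard minimiser dressed by the soft columns' averaged mismatch — all three already typed.  THIS FILE closes the table.

WHAT THIS FILE PROVES (0 sorry, 0 `def`, nothing cited; letters of PARTs 105 ∕ 106 ∕ 113):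
* §1 **`flucCov_eq_inv_sub`** (`𝒢 = K⁻¹ − ℋ·(K⁻¹Qᵀ)ᵀ` under `K` coercive + UB), **`avg_flucCov_sub_eq`** (the exact split above, ANY `Q′` on the finer lattice).
* §2 **`abs_avg_flucCov_sub_le`** — LETTER FORM: with `|E(x,x′)| ≤ εe^{−δD(x,x′)}`, `|(Qf·ℋ′ − ℋ)(x,b)| ≤ A₁e^{−sσ(x,b)}`, `|(Qf·K′⁻¹Q′ᵀ)(x′,b)| ≤ c′e^{−sσ(x′,b)}`,
  `|ℋ(x,b)| ≤ A₂e^{−sσ(x,b)}`, `|(Qf·K′⁻¹Q′ᵀ − K⁻¹Qᵀ)(x′,b)| ≤ ε₁e^{−sσ(x′,b)}` (`0 < s ≤ 2δ`), the fine–unit–fine compatibility `D(x,x′) ≤ σ(x,b) + σ(x′,b)`, `D ≥ 0` and the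
  fine-to-unit profile `Kσ`: `|(Qf·𝒢′·Qfᵀ − 𝒢)(x,x′)| ≤ (ε + (A₁c′ + A₂ε₁)·Kσ(s∕2))·e^{−(s∕2)D(x,x′)}`.
* §3 **`abs_avg_flucCov_sub_le_of_soft`** — THE END, FROM THE ONE SOFT LETTER: under PART 113 `abs_avg_minOp_sub_le_of_soft`'s hypotheses (`Q′ = Q·Qf`) plus the two fine letters of
  PART 106: `|(Qf·𝒢′·Qfᵀ − 𝒢)(x,x′)| ≤ (ε + (A₁·(c₁ + ε₁) + A₂·ε₁)·Kσ(m∕4))·e^{−(m∕4)D(x,x′)}` with `t = rate Kf (Λ+a)⁻¹ c₀ δ₀`, `m = min δ₁ (t∕2)`, `ε₁ = q₁εe^{δR′}`,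
  `ε₂ = q₁²εe^{δR}`, `A₁ = (2(Λ+a)ε₁ + 4(Λ+a)²Kf(t∕2)²c₁ε₂)·Kf(m∕2)` (PART 112's constant), `A₂ = 2(Λ+a)c₁Kf(min δ₁ t ∕ 2)` (PART 105's) — it VANISHES at `ε = 0`.
WHAT IT DOES NOT DO: supply `E`'s law or the decay letters (Bałaban-class with background); instantiate.  SUPPLIER work on route C-R6° (rank 2, REDUCTION); no consumer of record;
NEVER «G-an2-4 closed»; NOT (CONV-C), NOT D1, NOT `BetaPertH`, NOT continuum, NOT Clay.  Records: `HOME/b2b-balaban-gan24-p3/gen50/README.md`.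
-/

noncomputable section

open scoped BigOperators Matrix
open Finset Matrix
open Literature.MathematicalPhysics.QuantumFieldTheory.Balaban1983to89
open Literature.MathematicalPhysics.QuantumFieldTheory.Balaban1983to89.B4Sect5Torus (IsPseudoDist SumBound rate rate_pos rate_le_delta0)
open Literature.MathematicalPhysics.QuantumFieldTheory.Balaban1983to89.Beta.Composition (blockProp)
open Literature.MathematicalPhysics.QuantumFieldTheory.Balaban1983to89.Beta.CompositionSingular (minOp flucCov blocks_eq_of_reg)
open Summit.QuantumFields.BalabanUV.Beta.GAN24.EffectiveFormLocalisation (transpose_reg blockProp_coercive_of_ub isUnit_det_of_coercive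
  isUnit_det_of_coercive_fine abs_minOp_le)
open Summit.QuantumFields.BalabanUV.Beta.GAN24.FluctuationCovarianceLocalisation (sum_exp_fine_le)
open Summit.QuantumFields.BalabanUV.Beta.GAN24.BlockRatesFromSoftResolvent (abs_avg_col_sub_le_of_soft abs_avg_minOp_sub_le_of_soft)

namespace Summit.QuantumFields.BalabanUV.Beta.GAN24.FluctuationCovarianceRateTransfer

variable {c ν ν' : Type*} [Fintype c] [Fintype ν] [Fintype ν'] [DecidableEq c] [DecidableEq ν] [DecidableEq ν']
variable {H : Matrix ν ν ℝ} {Q : Matrix c ν ℝ} {H' : Matrix ν' ν' ℝ} {Q' : Matrix c ν' ℝ} {a : ℝ}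

/-! ## §1 The fluctuation covariance as the soft resolvent minus dressed columns, and the exact split of its sandwiched increment -/

omit [Fintype ν'] [DecidableEq ν'] in
/-- **`flucCov_eq_inv_sub` — `𝒢 = K⁻¹ − ℋ·(K⁻¹Qᵀ)ᵀ`** [our proof; `blocks_eq_of_reg` BY NAME]: `H` symmetric with nonnegative form, `a > 0`, `K = H + Qᵀ(a•1)Q` coercive, upper bound in
trial form ⟹ `flucCov H Q = K⁻¹ − minOp H Q · (K⁻¹Qᵀ)ᵀ` (the matrix form of PART 106 `flucCov_apply_eq`). -/
theorem flucCov_eq_inv_sub (hH : Hᵀ = H) (hpsd : ∀ z : ν → ℝ, 0 ≤ z ⬝ᵥ (H *ᵥ z)) (ha : 0 < a) {γ : ℝ} (hγ : 0 < γ)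
    (hK : QGQInverse.Coercive (H + Qᵀ * (a • (1 : Matrix c c ℝ)) * Q) γ) {Λ : ℝ} (hΛ : 0 ≤ Λ)
    (hUB : ∀ B : c → ℝ, ∃ u : ν → ℝ, Q *ᵥ u = B ∧ u ⬝ᵥ (H *ᵥ u) ≤ Λ * (B ⬝ᵥ B)) :
    flucCov H Q = (H + Qᵀ * (a • (1 : Matrix c c ℝ)) * Q)⁻¹ -
      minOp H Q * ((H + Qᵀ * (a • (1 : Matrix c c ℝ)) * Q)⁻¹ * Qᵀ)ᵀ := by
  have hΛa : 0 < Λ + a := by linarith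
  have hPco : QGQInverse.Coercive (blockProp (H + Qᵀ * (a • (1 : Matrix c c ℝ)) * Q) Q) (Λ + a)⁻¹ :=
    blockProp_coercive_of_ub hH hpsd ha hγ hK hΛ hUB
  have hKdet : IsUnit (H + Qᵀ * (a • (1 : Matrix c c ℝ)) * Q).det := isUnit_det_of_coercive_fine hγ hK
  have hPdet : IsUnit (blockProp (H + Qᵀ * (a • (1 : Matrix c c ℝ)) * Q) Q).det := isUnit_det_of_coercive (inv_pos.mpr hΛa) hPco
  obtain ⟨-, hM, hC⟩ := blocks_eq_of_reg H Q (a • (1 : Matrix c c ℝ)) hKdet hPdet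
  rw [hC, Beta.Envelope.constrProp, Beta.Envelope.minMap, ← hM, transpose_mul, transpose_transpose, transpose_nonsing_inv,
    transpose_reg hH a, Matrix.mul_assoc (minOp H Q)]

/-- **`avg_flucCov_sub_eq` — THE EXACT SPLIT OF THE SANDWICHED INCREMENT**: for an averaging `Qf` between the two fine lattices and ANY unit averaging `Q′` of the finer one,
`Qf·𝒢′·Qfᵀ − 𝒢 = (Qf·K′⁻¹·Qfᵀ − K⁻¹) − ((Qf·ℋ′ − ℋ)·(Qf·K′⁻¹Q′ᵀ)ᵀ + ℋ·(Qf·K′⁻¹Q′ᵀ − K⁻¹Qᵀ)ᵀ)`. [our proof] -/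
theorem avg_flucCov_sub_eq (Qf : Matrix ν ν' ℝ) (ha : 0 < a) {γ Λ : ℝ} (hγ : 0 < γ) (hΛ : 0 ≤ Λ)
    (hH : Hᵀ = H) (hpsd : ∀ z : ν → ℝ, 0 ≤ z ⬝ᵥ (H *ᵥ z)) (hK : QGQInverse.Coercive (H + Qᵀ * (a • (1 : Matrix c c ℝ)) * Q) γ)
    (hUB : ∀ B : c → ℝ, ∃ u : ν → ℝ, Q *ᵥ u = B ∧ u ⬝ᵥ (H *ᵥ u) ≤ Λ * (B ⬝ᵥ B))
    (hH' : H'ᵀ = H') (hpsd' : ∀ z : ν' → ℝ, 0 ≤ z ⬝ᵥ (H' *ᵥ z)) (hK' : QGQInverse.Coercive (H' + Q'ᵀ * (a • (1 : Matrix c c ℝ)) * Q') γ)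
    (hUB' : ∀ B : c → ℝ, ∃ u : ν' → ℝ, Q' *ᵥ u = B ∧ u ⬝ᵥ (H' *ᵥ u) ≤ Λ * (B ⬝ᵥ B)) :
    Qf * flucCov H' Q' * Qfᵀ - flucCov H Q =
      (Qf * (H' + Q'ᵀ * (a • (1 : Matrix c c ℝ)) * Q')⁻¹ * Qfᵀ - (H + Qᵀ * (a • (1 : Matrix c c ℝ)) * Q)⁻¹) -
        ((Qf * minOp H' Q' - minOp H Q) * (Qf * ((H' + Q'ᵀ * (a • (1 : Matrix c c ℝ)) * Q')⁻¹ * Q'ᵀ))ᵀ +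
          minOp H Q * (Qf * ((H' + Q'ᵀ * (a • (1 : Matrix c c ℝ)) * Q')⁻¹ * Q'ᵀ) - (H + Qᵀ * (a • (1 : Matrix c c ℝ)) * Q)⁻¹ * Qᵀ)ᵀ) := by
  rw [flucCov_eq_inv_sub hH hpsd ha hγ hK hΛ hUB, flucCov_eq_inv_sub hH' hpsd' ha hγ hK' hΛ hUB']
  simp only [Matrix.mul_sub, Matrix.sub_mul, transpose_sub, transpose_mul, transpose_transpose, Matrix.mul_assoc]
  abel

/-! ## §2 The sandwiched increment in letter form -/

section Letters

variable {σ : ν → c → ℝ} {D : ν → ν → ℝ} {Kσ : ℝ → ℝ}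

omit [Fintype ν] [DecidableEq c] [DecidableEq ν] in
/-- Two fine-to-unit letters at one rate convolve to a fine letter [our proof; PART 106 `sum_exp_fine_le`]: `|X(b)| ≤ Ae^{−sσ(x,b)}`, `|Y(b)| ≤ Be^{−sσ(x′,b)}` (`A, B ≥ 0`)
⟹ `|Σ_b X(b)Y(b)| ≤ A·B·Kσ(s∕2)·e^{−(s∕2)D(x,x′)}`. -/
theorem abs_sum_mul_le {X Y : c → ℝ} {A B s : ℝ} (hA : 0 ≤ A) (hB : 0 ≤ B) (hs : 0 < s) (hσ0 : ∀ x b, 0 ≤ σ x b)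
    (hDσ : ∀ x x' b, D x x' ≤ σ x b + σ x' b) (hKσ : ∀ s : ℝ, 0 < s → ∀ x : ν, ∑ b, Real.exp (-(s * σ x b)) ≤ Kσ s) {x x' : ν}
    (hX : ∀ b, |X b| ≤ A * Real.exp (-(s * σ x b))) (hY : ∀ b, |Y b| ≤ B * Real.exp (-(s * σ x' b))) :
    |∑ b, X b * Y b| ≤ A * B * Kσ (s / 2) * Real.exp (-(s / 2 * D x x')) := by
  calc |∑ b, X b * Y b| ≤ ∑ b, |X b * Y b| := Finset.abs_sum_le_sum_abs _ _
    _ ≤ ∑ b, A * Real.exp (-(s * σ x b)) * (B * Real.exp (-(s * σ x' b))) := Finset.sum_le_sum fun b _ => by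
        rw [abs_mul]; exact mul_le_mul (hX b) (hY b) (abs_nonneg _) (by positivity)
    _ = A * B * ∑ b, Real.exp (-(s * σ x b)) * Real.exp (-(s * σ x' b)) := by
        rw [Finset.mul_sum]; exact Finset.sum_congr rfl fun b _ => by ring
    _ ≤ A * B * (Kσ (s / 2) * Real.exp (-(s / 2 * D x x'))) :=
        mul_le_mul_of_nonneg_left (sum_exp_fine_le hσ0 hDσ hKσ hs x x') (by positivity)
    _ = A * B * Kσ (s / 2) * Real.exp (-(s / 2 * D x x')) := by ring

/-- **`abs_avg_flucCov_sub_le` — 𝒢's RATE IN LETTER FORM** [our proof; §1 + `abs_sum_mul_le`]: two constrained data under the identity hypotheses of `avg_flucCov_sub_eq`, and five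
letters at one fine-to-unit rate `s` (`0 < s ≤ 2δ`): the soft one-step letter `|E(x,x′)| ≤ εe^{−δD(x,x′)}` (`E = Qf·K′⁻¹·Qfᵀ − K⁻¹`), the Ξ-block's averaged mismatch
`|(Qf·ℋ′ − ℋ)(x,b)| ≤ A₁e^{−sσ(x,b)}`, the averaged soft columns `|(Qf·K′⁻¹Q′ᵀ)(x′,b)| ≤ c′e^{−sσ(x′,b)}`, the hard minimiser `|ℋ(x,b)| ≤ A₂e^{−sσ(x,b)}` and the soft
columns' averaged mismatch `|(Qf·K′⁻¹Q′ᵀ − K⁻¹Qᵀ)(x′,b)| ≤ ε₁e^{−sσ(x′,b)}` (`A₁, c′, A₂, ε₁ ≥ 0`), with `σ ≥ 0`, `D ≥ 0`, `D(x,x′) ≤ σ(x,b) + σ(x′,b)` and the profile `Kσ` ⟹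
`|(Qf·𝒢′·Qfᵀ − 𝒢)(x,x′)| ≤ (ε + (A₁c′ + A₂ε₁)·Kσ(s∕2))·e^{−(s∕2)D(x,x′)}`. -/
theorem abs_avg_flucCov_sub_le (Qf : Matrix ν ν' ℝ) (ha : 0 < a) {γ Λ : ℝ} (hγ : 0 < γ) (hΛ : 0 ≤ Λ)
    (hH : Hᵀ = H) (hpsd : ∀ z : ν → ℝ, 0 ≤ z ⬝ᵥ (H *ᵥ z)) (hK : QGQInverse.Coercive (H + Qᵀ * (a • (1 : Matrix c c ℝ)) * Q) γ)
    (hUB : ∀ B : c → ℝ, ∃ u : ν → ℝ, Q *ᵥ u = B ∧ u ⬝ᵥ (H *ᵥ u) ≤ Λ * (B ⬝ᵥ B))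
    (hH' : H'ᵀ = H') (hpsd' : ∀ z : ν' → ℝ, 0 ≤ z ⬝ᵥ (H' *ᵥ z)) (hK' : QGQInverse.Coercive (H' + Q'ᵀ * (a • (1 : Matrix c c ℝ)) * Q') γ)
    (hUB' : ∀ B : c → ℝ, ∃ u : ν' → ℝ, Q' *ᵥ u = B ∧ u ⬝ᵥ (H' *ᵥ u) ≤ Λ * (B ⬝ᵥ B))
    {ε δ s A₁ c' A₂ ε₁ : ℝ} (hε : 0 ≤ ε) (hs : 0 < s) (hsδ : s ≤ 2 * δ) (hA₁ : 0 ≤ A₁) (hc' : 0 ≤ c') (hA₂ : 0 ≤ A₂) (hε₁ : 0 ≤ ε₁)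
    (hσ0 : ∀ x b, 0 ≤ σ x b) (hD0 : ∀ x x', 0 ≤ D x x') (hDσ : ∀ x x' b, D x x' ≤ σ x b + σ x' b)
    (hKσ : ∀ s : ℝ, 0 < s → ∀ x : ν, ∑ b, Real.exp (-(s * σ x b)) ≤ Kσ s)
    (hE : ∀ x y, |(Qf * (H' + Q'ᵀ * (a • (1 : Matrix c c ℝ)) * Q')⁻¹ * Qfᵀ - (H + Qᵀ * (a • (1 : Matrix c c ℝ)) * Q)⁻¹) x y| ≤ ε * Real.exp (-(δ * D x y)))
    (hMis : ∀ x b, |(Qf * minOp H' Q' - minOp H Q) x b| ≤ A₁ * Real.exp (-(s * σ x b)))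
    (hCol' : ∀ x b, |(Qf * ((H' + Q'ᵀ * (a • (1 : Matrix c c ℝ)) * Q')⁻¹ * Q'ᵀ)) x b| ≤ c' * Real.exp (-(s * σ x b)))
    (hMin : ∀ x b, |minOp H Q x b| ≤ A₂ * Real.exp (-(s * σ x b)))
    (hColMis : ∀ x b, |(Qf * ((H' + Q'ᵀ * (a • (1 : Matrix c c ℝ)) * Q')⁻¹ * Q'ᵀ) - (H + Qᵀ * (a • (1 : Matrix c c ℝ)) * Q)⁻¹ * Qᵀ) x b| ≤
      ε₁ * Real.exp (-(s * σ x b))) (x x' : ν) :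
    |(Qf * flucCov H' Q' * Qfᵀ - flucCov H Q) x x'| ≤ (ε + (A₁ * c' + A₂ * ε₁) * Kσ (s / 2)) * Real.exp (-(s / 2 * D x x')) := by
  rw [avg_flucCov_sub_eq Qf ha hγ hΛ hH hpsd hK hUB hH' hpsd' hK' hUB', Matrix.sub_apply, Matrix.add_apply]
  set K : Matrix ν ν ℝ := H + Qᵀ * (a • (1 : Matrix c c ℝ)) * Q with hKdef
  set K' : Matrix ν' ν' ℝ := H' + Q'ᵀ * (a • (1 : Matrix c c ℝ)) * Q' with hK'def
  -- the three pieces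
  have h0 : |(Qf * K'⁻¹ * Qfᵀ - K⁻¹) x x'| ≤ ε * Real.exp (-(s / 2 * D x x')) :=
    (hE x x').trans (mul_le_mul_of_nonneg_left (Real.exp_le_exp.mpr (by nlinarith [hD0 x x'])) hε)
  have h1 : |((Qf * minOp H' Q' - minOp H Q) * (Qf * (K'⁻¹ * Q'ᵀ))ᵀ) x x'| ≤ A₁ * c' * Kσ (s / 2) * Real.exp (-(s / 2 * D x x')) := by
    rw [Matrix.mul_apply]
    exact abs_sum_mul_le hA₁ hc' hs hσ0 hDσ hKσ (fun b => hMis x b) (fun b => by rw [transpose_apply]; exact hCol' x' b)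
  have h2 : |(minOp H Q * (Qf * (K'⁻¹ * Q'ᵀ) - K⁻¹ * Qᵀ)ᵀ) x x'| ≤ A₂ * ε₁ * Kσ (s / 2) * Real.exp (-(s / 2 * D x x')) := by
    rw [Matrix.mul_apply]
    exact abs_sum_mul_le hA₂ hε₁ hs hσ0 hDσ hKσ (fun b => hMin x b) (fun b => by rw [transpose_apply]; exact hColMis x' b)
  calc |(Qf * K'⁻¹ * Qfᵀ - K⁻¹) x x' -
        (((Qf * minOp H' Q' - minOp H Q) * (Qf * (K'⁻¹ * Q'ᵀ))ᵀ) x x' + (minOp H Q * (Qf * (K'⁻¹ * Q'ᵀ) - K⁻¹ * Qᵀ)ᵀ) x x')|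
      ≤ |(Qf * K'⁻¹ * Qfᵀ - K⁻¹) x x'| +
          (|((Qf * minOp H' Q' - minOp H Q) * (Qf * (K'⁻¹ * Q'ᵀ))ᵀ) x x'| + |(minOp H Q * (Qf * (K'⁻¹ * Q'ᵀ) - K⁻¹ * Qᵀ)ᵀ) x x'|) :=
        (abs_sub _ _).trans (add_le_add le_rfl (abs_add_le _ _))
    _ ≤ ε * Real.exp (-(s / 2 * D x x')) +
          (A₁ * c' * Kσ (s / 2) * Real.exp (-(s / 2 * D x x')) + A₂ * ε₁ * Kσ (s / 2) * Real.exp (-(s / 2 * D x x'))) :=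
        add_le_add h0 (add_le_add h1 h2)
    _ = (ε + (A₁ * c' + A₂ * ε₁) * Kσ (s / 2)) * Real.exp (-(s / 2 * D x x')) := by ring

end Letters

/-! ## §3 The 𝒢-block's rate from the one soft letter -/

section End

variable {Qf : Matrix ν ν' ℝ} {ρ : c → c → ℝ} {Kf Kσ : ℝ → ℝ} {σ : ν → c → ℝ} {D : ν → ν → ℝ}

/-- **`abs_avg_flucCov_sub_le_of_soft` — 𝒢's RATE FROM THE SOFT RESOLVENT'S ONE-STEP LAW** [our proof; §2 + PART 113 `abs_avg_minOp_sub_le_of_soft` ∕ `abs_avg_col_sub_le_of_soft` + PART 105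
`abs_minOp_le` BY NAME]: under PART 113's hypotheses (two constrained data `(H, Q)`, `(H′, Q·Qf)` with PART 105's letters at both levels, the ONE soft letter
`|(Qf·K′⁻¹·Qfᵀ − K⁻¹)(x,y)| ≤ εe^{−δD(x,y)}` at `δ ≥ δ₀, δ₁`, the block ∕ fine-to-unit locality of `Q` with row mass `q₁ ≥ 0`, the soft-column decay `c₁e^{−δ₁σ}`) plus PART 106's fine letters (`D ≥ 0`,
`D(x,x′) ≤ σ(x,b) + σ(x′,b)`, profile `Kσ`):
`|(Qf·𝒢′·Qfᵀ − 𝒢)(x,x′)| ≤ (ε + (A₁·(c₁ + ε₁) + A₂·ε₁)·Kσ(m∕4))·e^{−(m∕4)D(x,x′)}`, `t = rate Kf (Λ+a)⁻¹ c₀ δ₀`, `m = min δ₁ (t∕2)`, `ε₁ = q₁εe^{δR′}`, `ε₂ = q₁²εe^{δR}`,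
`A₁ = (2(Λ+a)ε₁ + 4(Λ+a)²Kf(t∕2)²c₁ε₂)·Kf(m∕2)`, `A₂ = 2(Λ+a)c₁Kf(min δ₁ t ∕ 2)` — every term carries a factor `ε`: the 𝒢-block's RATE clause, like Σ's and Ξ's, costs the ONE
soft letter, PART 105's decay letters and the upper bound. -/
theorem abs_avg_flucCov_sub_le_of_soft (hKf : ∀ r, 0 < r → 0 ≤ Kf r) (hρ : IsPseudoDist ρ) (hS : SumBound ρ Kf) (ha : 0 < a)
    {γ Λ c₀ δ₀ ε δ q₁ R R' c₁ δ₁ : ℝ} (hγ : 0 < γ) (hΛ : 0 ≤ Λ) (hc₀ : 0 ≤ c₀) (hδ₀ : 0 < δ₀) (hε : 0 ≤ ε) (hδ : δ₀ ≤ δ)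
    (hc₁ : 0 ≤ c₁) (hδ₁ : 0 < δ₁) (hδ₁δ : δ₁ ≤ δ)
    (hH : Hᵀ = H) (hpsd : ∀ z : ν → ℝ, 0 ≤ z ⬝ᵥ (H *ᵥ z)) (hK : QGQInverse.Coercive (H + Qᵀ * (a • (1 : Matrix c c ℝ)) * Q) γ)
    (hUB : ∀ B : c → ℝ, ∃ u : ν → ℝ, Q *ᵥ u = B ∧ u ⬝ᵥ (H *ᵥ u) ≤ Λ * (B ⬝ᵥ B))
    (hP : ∀ b b', |blockProp (H + Qᵀ * (a • (1 : Matrix c c ℝ)) * Q) Q b b'| ≤ c₀ * Real.exp (-(δ₀ * ρ b b')))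
    (hH' : H'ᵀ = H') (hpsd' : ∀ z : ν' → ℝ, 0 ≤ z ⬝ᵥ (H' *ᵥ z))
    (hK' : QGQInverse.Coercive (H' + (Q * Qf)ᵀ * (a • (1 : Matrix c c ℝ)) * (Q * Qf)) γ)
    (hUB' : ∀ B : c → ℝ, ∃ u : ν' → ℝ, (Q * Qf) *ᵥ u = B ∧ u ⬝ᵥ (H' *ᵥ u) ≤ Λ * (B ⬝ᵥ B))
    (hP' : ∀ b b', |blockProp (H' + (Q * Qf)ᵀ * (a • (1 : Matrix c c ℝ)) * (Q * Qf)) (Q * Qf) b b'| ≤ c₀ * Real.exp (-(δ₀ * ρ b b')))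
    (hE : ∀ x y, |(Qf * (H' + (Q * Qf)ᵀ * (a • (1 : Matrix c c ℝ)) * (Q * Qf))⁻¹ * Qfᵀ - (H + Qᵀ * (a • (1 : Matrix c c ℝ)) * Q)⁻¹) x y| ≤
      ε * Real.exp (-(δ * D x y)))
    (hq₁ : 0 ≤ q₁) (hq : ∀ b, ∑ x, |Q b x| ≤ q₁) (hQρ : ∀ b x b' x', Q b x ≠ 0 → Q b' x' ≠ 0 → ρ b b' ≤ D x x' + R)
    (hQσ : ∀ b x x', Q b x' ≠ 0 → σ x b ≤ D x x' + R')
    (hσ0 : ∀ x b, 0 ≤ σ x b) (hσρ : ∀ x b b', σ x b ≤ σ x b' + ρ b' b)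
    (hT : ∀ x b, |((H + Qᵀ * (a • (1 : Matrix c c ℝ)) * Q)⁻¹ * Qᵀ) x b| ≤ c₁ * Real.exp (-(δ₁ * σ x b)))
    (hD0 : ∀ x x', 0 ≤ D x x') (hDσ : ∀ x x' b, D x x' ≤ σ x b + σ x' b)
    (hKσ : ∀ s : ℝ, 0 < s → ∀ x : ν, ∑ b, Real.exp (-(s * σ x b)) ≤ Kσ s) (x x' : ν) :
    |(Qf * flucCov H' (Q * Qf) * Qfᵀ - flucCov H Q) x x'| ≤
      (ε + ((2 * (Λ + a) * (q₁ * ε * Real.exp (δ * R')) +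
              4 * (Λ + a) ^ 2 * Kf (rate Kf (Λ + a)⁻¹ c₀ δ₀ / 2) ^ 2 * c₁ * (q₁ ^ 2 * ε * Real.exp (δ * R))) *
            Kf (min δ₁ (rate Kf (Λ + a)⁻¹ c₀ δ₀ / 2) / 2) * (c₁ + q₁ * ε * Real.exp (δ * R')) +
          2 * (Λ + a) * c₁ * Kf (min δ₁ (rate Kf (Λ + a)⁻¹ c₀ δ₀) / 2) * (q₁ * ε * Real.exp (δ * R'))) *
        Kσ (min δ₁ (rate Kf (Λ + a)⁻¹ c₀ δ₀ / 2) / 4)) *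
        Real.exp (-(min δ₁ (rate Kf (Λ + a)⁻¹ c₀ δ₀ / 2) / 4 * D x x')) := by
  set K : Matrix ν ν ℝ := H + Qᵀ * (a • (1 : Matrix c c ℝ)) * Q with hKdef
  set K' : Matrix ν' ν' ℝ := H' + (Q * Qf)ᵀ * (a • (1 : Matrix c c ℝ)) * (Q * Qf) with hK'def
  set t : ℝ := rate Kf (Λ + a)⁻¹ c₀ δ₀ with ht
  have hΛa : 0 < Λ + a := by linarith
  have htpos : 0 < t := rate_pos hKf (inv_pos.mpr hΛa) hc₀ hδ₀
  set m : ℝ := min δ₁ (t / 2) with hm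
  have hmpos : 0 < m := lt_min hδ₁ (by linarith)
  have hmδ₁ : m ≤ δ₁ := min_le_left _ _
  have hmm₀ : m ≤ min δ₁ t := le_min hmδ₁ ((min_le_right _ _).trans (by linarith))
  have hδ' : 0 ≤ δ := hδ₀.le.trans hδ
  set ε₁ : ℝ := q₁ * ε * Real.exp (δ * R') with hε₁
  set ε₂ : ℝ := q₁ ^ 2 * ε * Real.exp (δ * R) with hε₂
  have hε₁0 : 0 ≤ ε₁ := by positivity
  have hKfm : 0 ≤ Kf (m / 2) := hKf _ (by linarith)
  have hKfm₀ : 0 ≤ Kf (min δ₁ t / 2) := hKf _ (by linarith [lt_min hδ₁ htpos])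
  have hKft : 0 ≤ Kf (t / 2) := hKf _ (by linarith)
  set A₁ : ℝ := (2 * (Λ + a) * ε₁ + 4 * (Λ + a) ^ 2 * Kf (t / 2) ^ 2 * c₁ * ε₂) * Kf (m / 2) with hA₁
  set A₂ : ℝ := 2 * (Λ + a) * c₁ * Kf (min δ₁ t / 2) with hA₂
  have hA₁0 : 0 ≤ A₁ := by positivity
  have hA₂0 : 0 ≤ A₂ := by positivity
  -- rate reductions to the common fine-to-unit rate `s = m / 2`
  have hred : ∀ {r C : ℝ} (y : ν) (b : c), 0 ≤ C → m / 2 ≤ r → C * Real.exp (-(r * σ y b)) ≤ C * Real.exp (-(m / 2 * σ y b)) :=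
    fun y b hC hr => mul_le_mul_of_nonneg_left (Real.exp_le_exp.mpr (by nlinarith [hσ0 y b])) hC
  -- (i) the Ξ-block's averaged mismatch (PART 113), already at rate `m / 2`
  have hMis : ∀ y b, |(Qf * minOp H' (Q * Qf) - minOp H Q) y b| ≤ A₁ * Real.exp (-(m / 2 * σ y b)) := fun y b =>
    abs_avg_minOp_sub_le_of_soft hKf hρ hS ha hγ hΛ hc₀ hδ₀ hε hδ hc₁ hδ₁ hδ₁δ hH hpsd hK hUB hP hH' hpsd' hK' hUB' hP' hE hq hQρ hQσ hσ0 hσρ hT y b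
  -- (ii) the soft columns' averaged mismatch (PART 113) at rate `δ ≥ m / 2`
  have hColMis : ∀ y b, |(Qf * (K'⁻¹ * (Q * Qf)ᵀ) - K⁻¹ * Qᵀ) y b| ≤ ε₁ * Real.exp (-(m / 2 * σ y b)) := fun y b =>
    (abs_avg_col_sub_le_of_soft hε hδ' hE hq hQσ y b).trans (hred y b hε₁0 (by linarith [hmδ₁.trans hδ₁δ]))
  -- (iii) the averaged soft columns themselves: `Qf·K′⁻¹Q′ᵀ = K⁻¹Qᵀ + (Qf·K′⁻¹Q′ᵀ − K⁻¹Qᵀ)`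
  have hCol' : ∀ y b, |(Qf * (K'⁻¹ * (Q * Qf)ᵀ)) y b| ≤ (c₁ + ε₁) * Real.exp (-(m / 2 * σ y b)) := fun y b => by
    have hsplit : (Qf * (K'⁻¹ * (Q * Qf)ᵀ)) y b = (K⁻¹ * Qᵀ) y b + (Qf * (K'⁻¹ * (Q * Qf)ᵀ) - K⁻¹ * Qᵀ) y b := by
      rw [Matrix.sub_apply]; ring
    rw [hsplit]
    calc |(K⁻¹ * Qᵀ) y b + (Qf * (K'⁻¹ * (Q * Qf)ᵀ) - K⁻¹ * Qᵀ) y b|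
        ≤ |(K⁻¹ * Qᵀ) y b| + |(Qf * (K'⁻¹ * (Q * Qf)ᵀ) - K⁻¹ * Qᵀ) y b| := abs_add_le _ _
      _ ≤ c₁ * Real.exp (-(m / 2 * σ y b)) + ε₁ * Real.exp (-(m / 2 * σ y b)) :=
          add_le_add ((hT y b).trans (hred y b hc₁ (by linarith))) (hColMis y b)
      _ = (c₁ + ε₁) * Real.exp (-(m / 2 * σ y b)) := by ring
  -- (iv) the hard minimiser (PART 105) at rate `min δ₁ t / 2 ≥ m / 2`
  have hMin : ∀ y b, |minOp H Q y b| ≤ A₂ * Real.exp (-(m / 2 * σ y b)) := fun y b =>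
    (abs_minOp_le hKf hρ hS hH hpsd ha hγ hK hΛ hUB hc₀ hδ₀ hP hσ0 hσρ hc₁ hδ₁ hT y b).trans (hred y b hA₂0 (by linarith))
  have hfin := abs_avg_flucCov_sub_le Qf ha hγ hΛ hH hpsd hK hUB hH' hpsd' hK' hUB' hε (by linarith : 0 < m / 2)
    (by linarith [hmδ₁.trans hδ₁δ] : m / 2 ≤ 2 * δ) hA₁0 (by positivity : 0 ≤ c₁ + ε₁) hA₂0 hε₁0 hσ0 hD0 hDσ hKσ hE hMis hCol' hMin hColMis x x'
  have hm4 : m / 2 / 2 = m / 4 := by ring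
  rw [hm4] at hfin
  exact hfin

end End

end Summit.QuantumFields.BalabanUV.Beta.GAN24.FluctuationCovarianceRateTransfer

end
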